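import Summits.CriticalPhenomena.PercolationContinuityZ3.Theorems.PercNearOneGluingNoHeavyRsw3AnnulusTwoArmCriticalAspect
import HarnessLib

/-!
# RSW3 lane (P2, gen 13): counting forms of the every-aspect annulus two-arm theorem (census vocabulary `annulusClusterCount`)

builds on p205010 (kernel theorem, internal audit signed; external expert review pending)

Cell `prim-rsw3`, prover seat `prim-rsw3-p2` (gen 13), memo `run/shared/lean/prim/rsw3/P2-RSWLITE.md` §20.
Support file (`--supports stmt-CriticalPhenomena-4575`); no definitions, no named facts, no sorries.  `(uniqZone m M)ᶜ ⊆ {2 ≤ annulusClusterCount 3 m M}`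
(gen 4 `real_compl_uniqZone_le_real_two_le_annulusClusterCount`), so the theorems of `…Rsw3AnnulusTwoArmCriticalAspect` read: at `p_c(ℤ³)` at least two distinct
open clusters of `Λ(M)` join `Λ(m)` to `∂ⁱⁿΛ(M)` with probability `≥ c` for every `1 ≤ m ≤ M ≤ 3m` (gen 10: `M ≤ 2m`), and for every integer aspect `t ≥ 3` at one of
the two scales `N`, `⌊N/⌊t/2⌋⌋`.

References: M. Aizenman, Nucl. Phys. B 485 (1997) 551–582, §2 Thm. 2, Remark 2 [Aizenman1997]; C. Borgs, J. Chayes, H. Kesten, J. Spencer, Random Structures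
Algorithms 15 (1999) 368–413, §1 [BorgsChayesKestenSpencer1999]. [folklore]
-/

noncomputable section

namespace Summit.CriticalPhenomena.PercolationContinuityZ3.Theorems.Rsw3

open MeasureTheory Literature.Probability.LatticeModels Literature.Probability.Percolation
open Literature.Probability.Percolation.KozmaNitzan Summit.CriticalPhenomena.PercolationContinuityZ3.Theorems.Crossing SurfaceTension

/-! ## Counting forms (census vocabulary) -/

/-- **Counting form at aspect `3`:** `∃ c > 0, ∀ N ≥ 1, c ≤ P_{p_c(ℤ³)}(2 ≤ annulusClusterCount 3 N (3N))` — at least two distinct open clusters of `Λ(3N)` join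
`Λ(N)` to `∂ⁱⁿΛ(3N)`, with probability bounded below uniformly in the scale (census Q5/Q7 vocabulary; gen 10: `(N, 2N)`).
builds on p205010 (kernel theorem, internal audit signed; external expert review pending). [cite: Aizenman1997, §2 Thm. 2 and Remark 2] -/
theorem exists_le_real_two_le_annulusClusterCount_criticalProbI_three :
    ∃ c : ℝ, 0 < c ∧ ∀ N : ℕ, 1 ≤ N →
      c ≤ (bondPercolation (zdGraph 3) (criticalProbI 3)).real {ω | 2 ≤ annulusClusterCount 3 N (3 * N) ω} := by
  obtain ⟨c, hc, h⟩ := exists_le_annulusTwoArmProb_criticalProbI_three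
  exact ⟨c, hc, fun N hN => (h N hN).trans
    (real_compl_uniqZone_le_real_two_le_annulusClusterCount 3 (criticalProbI 3) N (3 * N))⟩

/-- **Counting form, every aspect `≤ 3`:** `∃ c > 0, ∀ m M, 1 ≤ m → m ≤ M → M ≤ 3m → c ≤ P_{p_c(ℤ³)}(2 ≤ annulusClusterCount 3 m M)`.
builds on p205010 (kernel theorem, internal audit signed; external expert review pending). [cite: Aizenman1997, §2 Remark 2] -/
theorem exists_le_real_two_le_annulusClusterCount_criticalProbI_of_aspect_le_three :
    ∃ c : ℝ, 0 < c ∧ ∀ m M : ℕ, 1 ≤ m → m ≤ M → M ≤ 3 * m →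
      c ≤ (bondPercolation (zdGraph 3) (criticalProbI 3)).real {ω | 2 ≤ annulusClusterCount 3 m M ω} := by
  obtain ⟨c, hc, h⟩ := exists_le_annulusTwoArmProb_criticalProbI_of_aspect_le_three
  exact ⟨c, hc, fun m M hm hmM hM => (h m M hm hmM hM).trans
    (real_compl_uniqZone_le_real_two_le_annulusClusterCount 3 (criticalProbI 3) m M)⟩

/-- **Counting form of the two-scale theorem, every integer aspect `t ≥ 3`:** at every scale `N ≥ 1`, two distinct crossing clusters of the aspect-`t` annulus
have probability `≥ c_t` at scale `N` or at scale `⌊N/⌊t/2⌋⌋`.  builds on p205010 (kernel theorem, internal audit signed; external expert review pending).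
[cite: Aizenman1997, §2 Remark 2] -/
theorem exists_le_max_real_two_le_annulusClusterCount_criticalProbI_aspect (t : ℕ) (ht : 3 ≤ t) :
    ∃ c : ℝ, 0 < c ∧ ∀ N : ℕ, 1 ≤ N →
      c ≤ max ((bondPercolation (zdGraph 3) (criticalProbI 3)).real {ω | 2 ≤ annulusClusterCount 3 N (t * N) ω})
        ((bondPercolation (zdGraph 3) (criticalProbI 3)).real {ω | 2 ≤ annulusClusterCount 3 (N / (t / 2)) (t * (N / (t / 2))) ω}) := by
  obtain ⟨c, hc, h⟩ := exists_le_max_annulusTwoArmProb_criticalProbI_aspect t ht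
  refine ⟨c, hc, fun N hN => (h N hN).trans (max_le_max ?_ ?_)⟩
  · exact real_compl_uniqZone_le_real_two_le_annulusClusterCount 3 (criticalProbI 3) N (t * N)
  · exact real_compl_uniqZone_le_real_two_le_annulusClusterCount 3 (criticalProbI 3) (N / (t / 2)) (t * (N / (t / 2)))

end Summit.CriticalPhenomena.PercolationContinuityZ3.Theorems.Rsw3

end
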